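import Literature.AlgebraicGeometry.Motives.GrassmannianRepresentable
import Literature.AlgebraicGeometry.Motives.OpenSubfunctorCoverCharts
import HarnessLib

/-!
# The Grassmannian scheme is covered by the affine spaces `Spec ℤ[X_I]` (the standard open charts)

Topic `Literature/AlgebraicGeometry/Motives`; namespace `Literature.AlgebraicGeometry.Motives.Grassmannian`.  Sequel to (A4)
`GrassmannianRepresentable` (cell hodgecm-mathlib key (h4); B-p18 (g17)).  THEOREMS ONLY.

Under `[(grassmannianSheaf M k).obj.IsRepresentable]` (★ `isRepresentable_grassmannianSheaf` for `M` free) B-p21's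
`grassmannianScheme M k` represents the Grassmannian sheaf, with `pointsEquiv T : (T ⟶ grassmannianScheme M k) ≃ Gr(T)`.  For a basis
`b : J → M` and an injective `I : Fin k → J`, THE CHART IMMERSION is the morphism classified by the universal chart element,
`(pointsEquiv _).symm (chartElem k M b I hI) : chartScheme k I = Spec ℤ[X_I] ⟶ grassmannianScheme M k`.

* `pointsEquiv_comp_symm_chartElem` — on `T`-points the chart immersion is the chart map `chartMap I`;
* `pointsEquiv_comp_symm_app_id`, `isIso_pointsEquiv_symm_app_id` — comparison of any representing pair `(Y, e)` with
  `grassmannianScheme` (Yoneda);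
* **`isOpenImmersion_pointsEquiv_symm_chartElem`** — each chart immersion is an OPEN IMMERSION;
* **`exists_mem_range_pointsEquiv_symm_chartElem`** — the chart immersions COVER `grassmannianScheme M k`;
  so the Grassmannian scheme has the standard open cover by affine spaces `𝔸^{k · #(J ∖ I)}` ([Stacks 089T]: «`G(k, n)` has an open
  covering by `n choose k` affine spaces»; EGA I 9.7.4; [GortzWedhorn2020, (8.4), Cor. 8.15]).  Source of the open immersions: B-p09's
  ★ `exists_iso_openCover_of_openCondition_cover` applied to the chart data of (A4), transported along the Yoneda comparison.

HC_CM is proved only modulo the 7 printed citations until rung 0 closes; nothing here is about HC.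
-/

noncomputable section

namespace Literature.AlgebraicGeometry.Motives.Grassmannian

open CategoryTheory Opposite TensorProduct _root_.AlgebraicGeometry

universe u

variable (k : ℕ) (M : Type u) [AddCommGroup M] {J : Type u} (b : Module.Basis J ℤ M)
variable [(grassmannianSheaf M k).obj.IsRepresentable]

/-! ## §1 Functor of points of the chart immersion; the Yoneda comparison -/

/-- **On `T`-points, the chart immersion `Spec ℤ[X_I] ⟶ Gr` is the chart map `chartMap I`.** [cite: StacksProject, Tag 089T] -/
theorem pointsEquiv_comp_symm_chartElem (I : Fin k → J) (hI : Function.Injective I) {T : Scheme.{u}} (t : T ⟶ chartScheme k I) :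
    pointsEquiv M k T (t ≫ (pointsEquiv M k (chartScheme k I)).symm (chartElem k M b I hI)) =
      (chartMap k M b I hI).app (op T) t := by
  rw [pointsEquiv_comp, Equiv.apply_symm_apply, chartMap_app_apply]

variable {M k} in
/-- For any pair `(Y, e : h_Y ≅ Gr)` representing the Grassmannian sheaf, the comparison morphism `Y ⟶ grassmannianScheme M k`
classified by `e(𝟙_Y) ∈ Gr(Y)` is, on `T`-points, `e` itself. [cite: GortzWedhorn2020, (8.4) (pp. 213–215)] -/
theorem pointsEquiv_comp_symm_app_id {Y : Scheme.{u}} (e : yoneda.obj Y ≅ (grassmannianSheaf M k).obj) {T : Scheme.{u}}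
    (x : T ⟶ Y) :
    pointsEquiv M k T (x ≫ (pointsEquiv M k Y).symm (e.hom.app (op Y) (𝟙 Y))) = e.hom.app (op T) x := by
  rw [pointsEquiv_comp, Equiv.apply_symm_apply, ← NatTrans.naturality_apply e.hom x.op (𝟙 Y)]
  simp only [yoneda_obj_map, Quiver.Hom.unop_op, TypeCat.ofHom_apply, Category.comp_id]

variable {M k} in
/-- **The comparison morphism of a representing pair is an isomorphism** (Yoneda: it induces `e ≫ reprW⁻¹` on functors of points).
[cite: GortzWedhorn2020, (8.4) (pp. 213–215)] -/
theorem isIso_pointsEquiv_symm_app_id {Y : Scheme.{u}} (e : yoneda.obj Y ≅ (grassmannianSheaf M k).obj) :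
    IsIso ((pointsEquiv M k Y).symm (e.hom.app (op Y) (𝟙 Y))) := by
  set ψ := (pointsEquiv M k Y).symm (e.hom.app (op Y) (𝟙 Y)) with hψ
  have h : yoneda.map ψ ≫ (grassmannianSheaf M k).obj.reprW.hom = e.hom := by
    ext T x
    change pointsEquiv M k (unop T) (x ≫ ψ) = e.hom.app T x
    exact pointsEquiv_comp_symm_app_id e x
  haveI : IsIso (yoneda.map ψ) := by
    rw [(Iso.eq_comp_inv _).mpr h]
    infer_instance
  exact Yoneda.fullyFaithful.isIso_of_isIso_map ψ

/-! ## §2 The chart immersions are open immersions covering the Grassmannian scheme -/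

/-- The chart data of (A4) yield, by ★ `exists_iso_openCover_of_openCondition_cover`, a representing scheme `Y` covered by open
immersions from the chart schemes; the chart immersions into `grassmannianScheme M k` are these followed by the comparison
isomorphism. [cite: GortzWedhorn2020, (8.4), Cor. 8.15] -/
theorem exists_openCover_chartScheme :
    ∃ (Y : Scheme.{u}) (e : yoneda.obj Y ≅ (grassmannianSheaf M k).obj)
      (g : ∀ I : {I : Fin k → J // Function.Injective I}, chartScheme k I.1 ⟶ Y),
      (∀ I, IsOpenImmersion (g I)) ∧ (∀ y : Y, ∃ I, y ∈ Set.range (g I)) ∧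
        ∀ I, (pointsEquiv M k (chartScheme k I.1)).symm (chartElem k M b I.1 I.2) =
          g I ≫ (pointsEquiv M k Y).symm (e.hom.app (op Y) (𝟙 Y)) := by
  obtain ⟨Y, e, g, hopen, hcov, hcomp⟩ := exists_iso_openCover_of_openCondition_cover (grassmannianSheaf M k)
    (ι := {I : Fin k → J // Function.Injective I}) (X := fun I => chartScheme k I.1)
    (fun I => chartMap k M b I.1 I.2) (fun I T => chartMap_app_injective k M b I.1 I.2 T)
    (fun I {T} y => chartLocus (⇑b ∘ I.1) y)
    (fun I {T T'} y h => by rw [range_chartMap_app_eq, ← map_mem_chartSubsheaf_iff])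
    (fun K _ y => exists_mem_range_chartMap_app_of_field k M b K y)
  refine ⟨Y, e, g, hopen, hcov, fun I => ?_⟩
  apply (pointsEquiv M k (chartScheme k I.1)).injective
  rw [Equiv.apply_symm_apply, pointsEquiv_comp_symm_app_id]
  have h1 := congrArg yonedaEquiv (hcomp I)
  rw [yonedaEquiv_comp, yonedaEquiv_yoneda_map, chartMap, Equiv.apply_symm_apply] at h1
  exact h1.symm

/-- **THE CHART IMMERSIONS ARE OPEN IMMERSIONS**: for every injective `I : Fin k → J`, the morphism
`Spec ℤ[X_I] = chartScheme k I ⟶ grassmannianScheme M k` classified by the universal chart element is an open immersion.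
[cite: StacksProject, Tag 089T] [cite: GortzWedhorn2020, (8.4), Cor. 8.15] -/
theorem isOpenImmersion_pointsEquiv_symm_chartElem (I : Fin k → J) (hI : Function.Injective I) :
    IsOpenImmersion ((pointsEquiv M k (chartScheme k I)).symm (chartElem k M b I hI)) := by
  obtain ⟨Y, e, g, hopen, -, hcomp⟩ := exists_openCover_chartScheme k M b
  rw [hcomp ⟨I, hI⟩]
  haveI := hopen ⟨I, hI⟩
  haveI := isIso_pointsEquiv_symm_app_id e
  infer_instance

/-- **THE CHART IMMERSIONS COVER THE GRASSMANNIAN SCHEME**: every point of `grassmannianScheme M k` lies in the image of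
`Spec ℤ[X_I] ⟶ grassmannianScheme M k` for some injective `I : Fin k → J` — the standard open cover of the Grassmannian by affine
spaces. [cite: StacksProject, Tag 089T] [cite: GortzWedhorn2020, (8.4), Cor. 8.15] -/
theorem exists_mem_range_pointsEquiv_symm_chartElem (y : grassmannianScheme M k) :
    ∃ I : {I : Fin k → J // Function.Injective I},
      y ∈ Set.range ((pointsEquiv M k (chartScheme k I.1)).symm (chartElem k M b I.1 I.2)) := by
  obtain ⟨Y, e, g, -, hcov, hcomp⟩ := exists_openCover_chartScheme k M b
  haveI := isIso_pointsEquiv_symm_app_id e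
  set ψ := (pointsEquiv M k Y).symm (e.hom.app (op Y) (𝟙 Y)) with hψ
  obtain ⟨I, x, hx⟩ := hcov ((inv ψ) y)
  refine ⟨I, x, ?_⟩
  rw [hcomp I, Scheme.Hom.comp_apply, hx, ← Scheme.Hom.comp_apply, IsIso.inv_hom_id]
  rfl

end Literature.AlgebraicGeometry.Motives.Grassmannian

end
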